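import Summits.BirchSwinnertonDyer.Rank1Residual.ManinAdditive.TwistOrbitAtTwoA2EvenTwist
import Literature.NumberTheory.EllipticCurves.ManinConstantQuadraticTwistAtTwoProofs
import Literature.NumberTheory.EllipticCurves.ModularDegreeQuadraticTwistValuation
import Literature.NumberTheory.EllipticCurves.ManinConstantQuadraticTwistAtTwoOrdinaryProofs
import HarnessLib

/-!
# Twist-orbit transport of the Manin constant — ADD-ON part 3/4 (`TwistOrbitAtTwoA3EvenDegree`) to the typer's landing of T-an-6 (files F1–F3 =
# HOME/an/Sketch-an4v5.lean 2d253c8874352f93): the prime-2 theorems THM I′, E-an-18r, S-an-14, E-an-20, E-an-21,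
# the E-an-17 degree dichotomy at odd `q`, and the closed `(q*, q, q²)` obligations (§§9–14 of the planner's
# leaf HOME/an/Leaf-TwistOrbitManinTransport.lean f491d1e88c8dc766, VERBATIM).

PROVENANCE / HOW TO LAND. Cell `bsd-f2-manin`, planner `bsd-f2-manin-an` g3. This file = exactly the
declarations of the leaf f491d1e88c8dc766 that are NOT in Sketch-an4v5 (the typer's F1–F3 source), in leaf
order, importing F1–F3 under the module names the typer announced (STATUS 18:40Z: `TwistOrbitManinStatements`
(p556717), `TwistOrbitDegreeIdentity`, `TwistOrbitManinTransportProof`) — adjust the three `import Summits.…`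
lines to the landed names. It was compiled on the farm as HOME/an/Addon-AtTwo-simulated.lean (= Sketch-an4v5
body with the cell namespace + this body): rc 0 · 0 err · 0 warn · 0 sorries; audit ok. It needs from F1–F3
only: `not_good_and_not_mult_of_sq_dvd_conductorNorm`, `u_sq_eq_one_of_smul_quadraticTwist_of_Δ`,
`deg_mul_c_sq_eq_of_pStar`, `maninConstant_dvd_mul_of_charTwist_gamma0`, `twistOrbitManinTransport_pStar`,
`commutingOrbitManinChain_pStar`, `orbitDegreeManinIdentity_pStar`, `maninEqOfNotDvdDegree_pStar_holds`,
`flipOrbitManinEq_pStar`, `twistPartnerDegreeBound_pStar`, `twistMinimalDegreeRoadTransport_pStar`,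
`orbitManinDefectLeOne_pStar`, the statement schemas, and `natAbs_eq_and_deg_eq_of_chain`; if the typer renamed
any of them (dedup), rename here too.  Split for the 400-line rule at the `section` boundaries
(`OddDichotomy` | `Closed` | `EvenTwist`+`ClosedEven` | `EvenDegree`+`ClosedEvenDegree` | `ExactAtTwo`).

RESULTS (all kernel-checked, no `sorry`, every `@[conjecture] def` closed by a hypothesis-free `_holds` or a
generic `_of_` theorem; statements, census numbers and references: the leaf's module docstring and
HOME/MEMO-an.md §§27–39; HOME/CANDIDATES.md rows E-an-17, E-an-18/18c/18v, E-an-18r/S-an-14, E-an-20, E-an-21).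
-/

noncomputable section

open scoped MatrixGroups ModularForm

open CongruenceSubgroup WeierstrassCurve
  Literature.NumberTheory.DiophantineGeometry
  Literature.NumberTheory.EllipticCurves
  Literature.NumberTheory.EllipticCurves.ModularForms

namespace Summit.BirchSwinnertonDyer.Rank1Residual.ManinAdditive

section EvenDegree

open IsDedekindDomain Rat.HeightOneSpectrum

/-! ## §12 COMMUTING same-level orbits at `2`: the backward chain `c ∣ 2d·c′`, Watkins' identity with
## `|d| ∈ {1, 2}` (S-an-14), and the DEGREE TETRACHOTOMY (E-an-20) from THEOREM I′

On a commuting orbit (`u • (W ⊗ χ_d) = W′` on the nose, `Δ(W′) = d⁶Δ(W)`, so `u.u = ±1` and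
`Λ_{W′} = ± s⁻¹ Λ_W`, `s = g(χ)/2`): forward `g(χ) z ∈ Λ_W ⟹ 2z ∈ Λ_{W′}` (§10, `c′ ∣ 2c`) and backward
`g(χ) z ∈ Λ_{W′} ⟹ 2d·z ∈ Λ_W` (`c ∣ 2d·c′`); with Watkins' identity `deg′·c² = |d|·deg·c′²` (tree
`deg_mul_sq_mul_sq_eq_of_quadraticTwist_of_natAbs_eq`, from equal `|aₙ|`) this pins
`deg′ ∈ {deg/4, deg, 4·deg}` (`d = −1`) resp. `deg′ ∈ {deg/8, deg/2, 2·deg, 8·deg}` (`d = ±2`), and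
`deg′ = |d|·deg ⟺ c′ = ±c`: on `χ₋₄`-orbits MANIN INVARIANCE ⟺ DEGREE INVARIANCE, decidable by modular
symbols without computing a Manin constant. -/

/-- **Backward lattice step on a commuting orbit: `g(χ) z ∈ Λ_{W′} ⟹ 2d·z ∈ Λ_W`** (`u • (W ⊗ χ_d) = W′`,
`Δ(W′) = d⁶Δ(W)` so `u.u = ±1`, `g(χ)² = 4d`, `Λ_{W′} = ± (g(χ)/2)⁻¹ Λ_W`). [cite: Pal2012, Lemma 3.1] -/
theorem neronLattice_mem_of_twist_of_gaussSum_sq_rev {W W' : WeierstrassCurve ℚ} [W.IsElliptic]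
    {d : ℚ} (hd : d ≠ 0) (u : VariableChange ℚ) (hu : u • W.quadraticTwist d = W')
    (hΔ : W'.Δ = d ^ 6 * W.Δ) {G : ℂ} (hG : G ^ 2 = 4 * (d : ℂ))
    {L L' : PeriodPair} (hL : IsNeronLatticeOf (W.baseChange ℂ) L)
    (hL' : IsNeronLatticeOf (W'.baseChange ℂ) L') (z : ℂ) (hz : G * z ∈ L'.lattice) :
    (2 * (d : ℂ)) * z ∈ L.lattice := by
  have hs2 : (G / 2) ^ 2 = (d : ℂ) := by rw [div_pow, hG]; ring
  have hd0 : (d : ℂ) ≠ 0 := by exact_mod_cast hd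
  have hs0 : G / 2 ≠ 0 := fun h0 ↦ hd0 (by rw [← hs2, h0]; simp)
  have hLT : IsNeronLatticeOf ((W.quadraticTwist d).baseChange ℂ) (L.mulLeft (G / 2)⁻¹ (inv_ne_zero hs0)) :=
    WeierstrassCurve.isNeronLatticeOf_quadraticTwist_of_sq_eq d hL hs0 hs2
  have hL'' : IsNeronLatticeOf ((u • W.quadraticTwist d).baseChange ℂ) L' := by rw [hu]; exact hL'
  have hlat := IsNeronLatticeOf.lattice_eq_mulLeft_of_smul u hLT hL''
  have hu2 : ((u.u : ℚ)) ^ 2 = 1 := u_sq_eq_one_of_smul_quadraticTwist_of_Δ hd u hu hΔ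
  have hU : (u.u : ℚ) = 1 ∨ (u.u : ℚ) = -1 := sq_eq_one_iff.mp hu2
  have hGG : G / 2 * (G * z) = 2 * (d : ℂ) * z := by
    rw [show G / 2 * (G * z) = G ^ 2 / 2 * z by ring, hG]; ring
  rw [hlat, PeriodPair.mem_mulLeft_lattice, PeriodPair.mem_mulLeft_lattice, inv_inv] at hz
  rcases hU with h1 | h1
  · rw [h1, Rat.cast_one, inv_one, one_mul, hGG] at hz
    exact hz
  · rw [h1, Rat.cast_neg, Rat.cast_one, inv_neg, inv_one, neg_one_mul, mul_neg, hGG, neg_mem_iff] at hz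
    exact hz

/-- `|aₙ(W′)| = |aₙ(W)|` on a commuting `χ_d`-orbit at `2` (`u • (W ⊗ χ_d) = W′`; odd `n`:
`aₙ(W ⊗ χ_d) = ε(n)·aₙ(W)` with `|ε(n)| = 1`; even `n`: both vanish, `W`, `W′` additive at `2`). [folklore] -/
theorem natAbs_LFunction_eq_of_twist_even {W W' : WeierstrassCurve ℚ} [W.IsElliptic] [W'.IsElliptic]
    {d : ℚ} (hd : d ≠ 0) (u : VariableChange ℚ) (hu : u • W.quadraticTwist d = W')
    (ε : ℕ → ℤ) (hε : ∀ n : ℕ, ¬ 2 ∣ n → (ε n).natAbs = 1)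
    (hodd : ∀ n : ℕ, ¬ 2 ∣ n → (W.quadraticTwist d).LFunction n = ε n * W.LFunction n)
    (hW0 : ∀ n : ℕ, 2 ∣ n → W.LFunction n = 0) (hW'0 : ∀ n : ℕ, 2 ∣ n → W'.LFunction n = 0) (n : ℕ) :
    (W'.LFunction n).natAbs = (W.LFunction n).natAbs := by
  by_cases h2 : 2 ∣ n
  · rw [hW0 n h2, hW'0 n h2]
  · haveI := W.isElliptic_quadraticTwist hd
    rw [← hu, LFunction_smul, hodd n h2, Int.natAbs_mul, hε n h2, one_mul]

/-- Watkins' identity with levels as variables (so that `N(W′) = N(W)` can be substituted):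
`deg′·c²·1 = a·deg·c′²` when `|d| = a` and `u.u² = 1`. [cite: Watkins2002, §2.1 (p. 491)]
[cite: Delaunay2003, Thm 1] [cite: Pal2012, Lemma 3.1] -/
theorem deg_mul_c_sq_eq_of_twist_even {W W' : WeierstrassCurve ℚ} [W.IsElliptic] [W'.IsElliptic]
    {N N' : ℕ} [NeZero N] [NeZero N'] (hNN : N' = N) {d : ℚ} (hd : d ≠ 0)
    (u : VariableChange ℚ) (hu : u • W.quadraticTwist d = W')
    (habs : ∀ n : ℕ, (W'.LFunction n).natAbs = (W.LFunction n).natAbs)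
    (hu2 : (((u.u : ℚ)) : ℝ) ^ 2 = 1) {a : ℕ} (ha : |(d : ℝ)| = a)
    (D : ModularParametrizationData W N) (D' : ModularParametrizationData W' N') :
    (D'.modularDegree : ℤ) * D.c ^ 2 = (a : ℤ) * D.modularDegree * D'.c ^ 2 := by
  subst hNN
  have key := ModularParametrizationData.deg_mul_sq_mul_sq_eq_of_quadraticTwist_of_natAbs_eq d hd u hu
    habs D D'
  rw [hu2, mul_one, ha] at key
  have key' : (((D'.modularDegree : ℤ) * D.c ^ 2 : ℤ) : ℝ) =
      (((a : ℤ) * D.modularDegree * D'.c ^ 2 : ℤ) : ℝ) := by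
    push_cast
    simpa [ModularParametrizationData.modularDegree] using key
  exact_mod_cast key'

/-- Elementary: `2c = c′k`, `deg′·c² = a·deg·c′²`, `c ≠ 0` ⇒ `deg′·k² = 4a·deg`. [elementary] -/
theorem deg_mul_sq_eq_of_two_mul_eq {c c' k : ℤ} {deg deg' a : ℕ} (hc : c ≠ 0)
    (h2c : 2 * c = c' * k) (hI : (deg' : ℤ) * c ^ 2 = (a : ℤ) * deg * c' ^ 2) :
    (deg' : ℤ) * k ^ 2 = 4 * a * deg := by
  have hc2 : c ^ 2 ≠ 0 := pow_ne_zero 2 hc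
  have h : ((deg' : ℤ) * k ^ 2) * c ^ 2 = (4 * a * deg) * c ^ 2 := by
    linear_combination k ^ 2 * hI - (a : ℤ) * deg * (2 * c + c' * k) * h2c
  exact mul_right_cancel₀ hc2 h

/-- Elementary: `2c = c′k`, `2^j c′ = c k′` (`j ∈ {1, 2}`), `c′ ≠ 0` ⇒ `k ∣ 2^(j+1)`. [elementary] -/
theorem dvd_of_two_mul_eq_of_mul_eq {c c' k k' m : ℤ} (hc' : c' ≠ 0) (h2c : 2 * c = c' * k)
    (h2c' : m * c' = c * k') : k ∣ 2 * m := by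
  refine ⟨k', mul_left_cancel₀ hc' ?_⟩
  linear_combination 2 * h2c' + k' * h2c

/-- **S-an-14 `EvenCommutingOrbitDegreeIdentity d m` — Watkins' identity on a commuting same-level
`χ_d`-orbit at `2`** (`m² ∣ N`, `u • (W ⊗ χ_d) = W′`, `Δ(W′) = d⁶Δ(W)`; any data `D`, `D′`):
`deg φ_{W′}·c(D)² = |d|·deg φ_W·c(D′)²`.  In print in substance (Zagier/Watkins/Delaunay); PROVED below at
`(−1, 4)`, `(±2, 8)`; support for E-an-20. [cite: Watkins2002, §2.1 (p. 491)] [cite: Delaunay2003, Thm 1] -/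
@[conjecture] def EvenCommutingOrbitDegreeIdentity (d : ℤ) (m : ℕ) : Prop :=
  ∀ (W W' : WeierstrassCurve ℚ) [W.IsElliptic] [W.IsGloballyMinimal] [W'.IsElliptic]
    [W'.IsGloballyMinimal] [NeZero (W.conductorNorm ℤ)] [NeZero (W'.conductorNorm ℤ)]
    (u : VariableChange ℚ) (D : ModularParametrizationData W (W.conductorNorm ℤ))
    (D' : ModularParametrizationData W' (W'.conductorNorm ℤ)),
    m ^ 2 ∣ W.conductorNorm ℤ → W'.conductorNorm ℤ = W.conductorNorm ℤ →
    u • W.quadraticTwist ((d : ℤ) : ℚ) = W' → W'.Δ = ((d : ℤ) : ℚ) ^ 6 * W.Δ →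
    (D'.modularDegree : ℤ) * D.c ^ 2 = |d| * D.modularDegree * D'.c ^ 2

/-- **E-an-18r `EvenCommutingOrbitManinChain d m` — THEOREM I′ in BOTH directions on a commuting
same-level `χ_d`-orbit at `2`** (`m² ∣ N`, `u • (W ⊗ χ_d) = W′`, `Δ(W′) = d⁶Δ(W)`, both data
lattice-optimal): `c′ ∣ 2c` and `c ∣ 2d·c′`.  PROVED at `(−1, 4)` (`c′ ∣ 2c ∣ 4c′`), `(±2, 8)`
(`c′ ∣ 2c ∣ 8c′`). [cite: Stevens1989, Lemma (5.4)] [cite: Pal2012, Lemma 3.1] -/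
@[conjecture] def EvenCommutingOrbitManinChain (d : ℤ) (m : ℕ) : Prop :=
  ∀ (W W' : WeierstrassCurve ℚ) [W.IsElliptic] [W.IsGloballyMinimal] [W'.IsElliptic]
    [W'.IsGloballyMinimal] [NeZero (W.conductorNorm ℤ)] [NeZero (W'.conductorNorm ℤ)]
    (u : VariableChange ℚ) (D : ModularParametrizationData W (W.conductorNorm ℤ))
    (D' : ModularParametrizationData W' (W'.conductorNorm ℤ)),
    m ^ 2 ∣ W.conductorNorm ℤ → W'.conductorNorm ℤ = W.conductorNorm ℤ →
    u • W.quadraticTwist ((d : ℤ) : ℚ) = W' →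
    (∀ z ∈ D.L.lattice, ∃ w ∈ periodLattice D.f, z = D.c * w) →
    (∀ z ∈ D'.L.lattice, ∃ w ∈ periodLattice D'.f, z = D'.c * w) →
    W'.Δ = ((d : ℤ) : ℚ) ^ 6 * W.Δ → D'.c ∣ 2 * D.c ∧ D.c ∣ 2 * d * D'.c

/-- **E-an-20 at `χ₋₄`: `NegOneCommutingOrbitDegreeTrichotomy` — the DEGREE TRICHOTOMY on a same-level
`χ₋₄`-orbit (`4² ∣ N`, `Δ(W′) = Δ(W)`, both data lattice-optimal):**
`deg φ_{W′} ∈ {deg φ_W, 4·deg φ_W, deg φ_W/4}` and `deg φ_{W′} = deg φ_W ⟺ c(D′)² = c(D)²` — Manin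
invariance along the orbit is EQUIVALENT to degree invariance (Cremona, `N < 5·10⁵`, `2⁵ ∣ N`: degrees
equal on 148 277 / 148 277 orbits).  PROVED below (E-an-18r at `(−1,4)` + S-an-14); beyond print.
Why it might fail: it cannot (theorem); the conjectural residue is `deg′ = deg` always (⟺ E-an-10).
[cite: Stevens1989, Lemma (5.4)] [cite: Watkins2002, §2.1] -/
@[conjecture] def NegOneCommutingOrbitDegreeTrichotomy : Prop :=
  ∀ (W W' : WeierstrassCurve ℚ) [W.IsElliptic] [W.IsGloballyMinimal] [W'.IsElliptic]
    [W'.IsGloballyMinimal] [NeZero (W.conductorNorm ℤ)] [NeZero (W'.conductorNorm ℤ)]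
    (u : VariableChange ℚ) (D : ModularParametrizationData W (W.conductorNorm ℤ))
    (D' : ModularParametrizationData W' (W'.conductorNorm ℤ)),
    4 ^ 2 ∣ W.conductorNorm ℤ → W'.conductorNorm ℤ = W.conductorNorm ℤ →
    u • W.quadraticTwist (-1 : ℚ) = W' →
    (∀ z ∈ D.L.lattice, ∃ w ∈ periodLattice D.f, z = D.c * w) →
    (∀ z ∈ D'.L.lattice, ∃ w ∈ periodLattice D'.f, z = D'.c * w) → W'.Δ = W.Δ →
    (D'.modularDegree = D.modularDegree ∨ D'.modularDegree = 4 * D.modularDegree ∨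
      4 * D'.modularDegree = D.modularDegree) ∧
    (D'.modularDegree = D.modularDegree ↔ D'.c ^ 2 = D.c ^ 2)

/-- **E-an-20 at `χ_{±8}`: `TwoCommutingOrbitDegreeTetrachotomy d` (`d = ±2`, `8² ∣ N`, `Δ(W′) = 64Δ(W)`,
both data lattice-optimal):** `deg φ_{W′} ∈ {8·deg, 2·deg, deg/2, deg/8}` and
`deg φ_{W′} = 2·deg φ_W ⟺ c(D′)² = c(D)²` (Cremona, `2⁷ ∣ N`: ratio `2` on 14 056 / 14 056 commuting
orbits, `d = 2` and `d = −2`).  PROVED below at `d = ±2`. [cite: Stevens1989, Lemma (5.4)] [cite: Watkins2002, §2.1] -/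
@[conjecture] def TwoCommutingOrbitDegreeTetrachotomy (d : ℤ) : Prop :=
  ∀ (W W' : WeierstrassCurve ℚ) [W.IsElliptic] [W.IsGloballyMinimal] [W'.IsElliptic]
    [W'.IsGloballyMinimal] [NeZero (W.conductorNorm ℤ)] [NeZero (W'.conductorNorm ℤ)]
    (u : VariableChange ℚ) (D : ModularParametrizationData W (W.conductorNorm ℤ))
    (D' : ModularParametrizationData W' (W'.conductorNorm ℤ)),
    8 ^ 2 ∣ W.conductorNorm ℤ → W'.conductorNorm ℤ = W.conductorNorm ℤ →
    u • W.quadraticTwist ((d : ℤ) : ℚ) = W' →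
    (∀ z ∈ D.L.lattice, ∃ w ∈ periodLattice D.f, z = D.c * w) →
    (∀ z ∈ D'.L.lattice, ∃ w ∈ periodLattice D'.f, z = D'.c * w) →
    W'.Δ = ((d : ℤ) : ℚ) ^ 6 * W.Δ →
    (D'.modularDegree = 8 * D.modularDegree ∨ D'.modularDegree = 2 * D.modularDegree ∨
      2 * D'.modularDegree = D.modularDegree ∨ 8 * D'.modularDegree = D.modularDegree) ∧
    (D'.modularDegree = 2 * D.modularDegree ↔ D'.c ^ 2 = D.c ^ 2)

/-- **S-an-14 and E-an-18r, generic form** (hypotheses as in `evenTwistOrbitManinTransport_of_char`, plus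
the integer odd-`n` relation with a unimodular `ε`). -/
theorem evenCommuting_of_char {d : ℤ} (hd : d ≠ 0) {k : ℕ} [NeZero k]
    {χ : DirichletCharacter ℂ (2 * k)} (hχ : χ.IsQuadratic) (hprim : χ.IsPrimitive)
    (hG : gaussSum χ (ZMod.stdAddChar (N := 2 * k)) ^ 2 = 4 * ((d : ℤ) : ℂ))
    (ε : ℕ → ℤ) (hε : ∀ n : ℕ, ¬ 2 ∣ n → (ε n).natAbs = 1) (hεχ : ∀ n : ℕ, (ε n : ℂ) = χ n)
    (hodd : ∀ (X : WeierstrassCurve ℚ) [X.IsElliptic] (n : ℕ), ¬ 2 ∣ n →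
      (X.quadraticTwist ((d : ℤ) : ℚ)).LFunction n = ε n * X.LFunction n)
    {a : ℕ} (ha : |(d : ℝ)| = a) (haZ : (|d| : ℤ) = a) :
    EvenCommutingOrbitDegreeIdentity d (2 * k) ∧ EvenCommutingOrbitManinChain d (2 * k) := by
  haveI : Fact (Nat.Prime 2) := ⟨Nat.prime_two⟩
  haveI : NeZero (2 * k) := ⟨mul_ne_zero two_ne_zero (NeZero.ne k)⟩
  have hd0 : ((d : ℤ) : ℚ) ≠ 0 := by exact_mod_cast hd
  have heven : ∀ n : ℕ, 2 ∣ n → χ n = 0 := fun n hn ↦ by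
    refine χ.map_nonunit fun hun ↦ ?_
    have hcop := (ZMod.isUnit_iff_coprime n (2 * k)).mp hun
    exact absurd ((Nat.Coprime.coprime_dvd_left hn hcop).eq_one_of_dvd (dvd_mul_right 2 k)) (by norm_num)
  refine ⟨?_, ?_⟩
  · intro W W' _ _ _ _ _ _ u D D' hM hN hu hΔ
    have hM' : (2 * k) ^ 2 ∣ W'.conductorNorm ℤ := by rw [hN]; exact hM
    have h4 : 2 ^ 2 ∣ W.conductorNorm ℤ := dvd_trans (pow_dvd_pow_of_dvd (dvd_mul_right 2 k) 2) hM
    have h4' : 2 ^ 2 ∣ W'.conductorNorm ℤ := dvd_trans (pow_dvd_pow_of_dvd (dvd_mul_right 2 k) 2) hM'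
    obtain ⟨hngW, hnmW⟩ := not_good_and_not_mult_of_sq_dvd_conductorNorm W h4
    obtain ⟨hngW', hnmW'⟩ := not_good_and_not_mult_of_sq_dvd_conductorNorm W' h4'
    have hW0 : ∀ n : ℕ, 2 ∣ n → W.LFunction n = 0 := fun n hn ↦
      W.LFunction_apply_eq_zero_of_not_good_of_not_mult 2 hngW hnmW hn
    have hW'0 : ∀ n : ℕ, 2 ∣ n → W'.LFunction n = 0 := fun n hn ↦
      W'.LFunction_apply_eq_zero_of_not_good_of_not_mult 2 hngW' hnmW' hn
    have habs := natAbs_LFunction_eq_of_twist_even hd0 u hu ε hε (hodd W) hW0 hW'0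
    have hu2 : ((u.u : ℚ)) ^ 2 = 1 := u_sq_eq_one_of_smul_quadraticTwist_of_Δ hd0 u hu hΔ
    have hu2R : (((u.u : ℚ)) : ℝ) ^ 2 = 1 := by exact_mod_cast hu2
    have ha' : |((((d : ℤ) : ℚ)) : ℝ)| = a := by push_cast; exact ha
    rw [haZ]
    exact deg_mul_c_sq_eq_of_twist_even hN hd0 u hu habs hu2R ha' D D'
  · intro W W' _ _ _ _ _ _ u D D' hM hN hu hD hD' hΔ
    have hM' : (2 * k) ^ 2 ∣ W'.conductorNorm ℤ := by rw [hN]; exact hM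
    have h4 : 2 ^ 2 ∣ W.conductorNorm ℤ := dvd_trans (pow_dvd_pow_of_dvd (dvd_mul_right 2 k) 2) hM
    have h4' : 2 ^ 2 ∣ W'.conductorNorm ℤ := dvd_trans (pow_dvd_pow_of_dvd (dvd_mul_right 2 k) 2) hM'
    obtain ⟨hngW, hnmW⟩ := not_good_and_not_mult_of_sq_dvd_conductorNorm W h4
    obtain ⟨hngW', hnmW'⟩ := not_good_and_not_mult_of_sq_dvd_conductorNorm W' h4'
    have hW0 : ∀ n : ℕ, 2 ∣ n → W.LFunction n = 0 := fun n hn ↦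
      W.LFunction_apply_eq_zero_of_not_good_of_not_mult 2 hngW hnmW hn
    have hW'0 : ∀ n : ℕ, 2 ∣ n → W'.LFunction n = 0 := fun n hn ↦
      W'.LFunction_apply_eq_zero_of_not_good_of_not_mult 2 hngW' hnmW' hn
    have hoddC : ∀ (X : WeierstrassCurve ℚ) [X.IsElliptic] (n : ℕ), ¬ 2 ∣ n →
        (((X.quadraticTwist ((d : ℤ) : ℚ)).LFunction n : ℤ) : ℂ) = χ n * (X.LFunction n : ℂ) :=
      fun X _ n hn ↦ by rw [hodd X n hn, Int.cast_mul, hεχ]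
    have hG' : gaussSum χ (ZMod.stdAddChar (N := 2 * k)) ^ 2 = 4 * ((((d : ℤ) : ℚ)) : ℂ) := by
      rw [hG]; push_cast; ring
    have hNdvd : W.conductorNorm ℤ ∣ W'.conductorNorm ℤ := by rw [hN]
    have hNdvd' : W'.conductorNorm ℤ ∣ W.conductorNorm ℤ := by rw [hN]
    refine ⟨?_, ?_⟩
    · -- forward: E-an-18 clause 1 with `C := W'`
      have hcoef := fun n ↦
        cuspCoeff_eq_chi_mul_of_twist_even hd0 u hu rfl (hoddC W) heven hW'0 D D' n
      have hΔ1 : (1 : ℚ) ^ 12 * W'.Δ = ((d : ℤ) : ℚ) ^ 6 * W.Δ := by rw [one_pow, one_mul]; exact hΔ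
      have hmem : ∀ z : ℂ, gaussSum χ (ZMod.stdAddChar (N := 2 * k)) * z ∈ D.L.lattice →
          ((2 : ℤ) : ℂ) * z ∈ D'.L.lattice := fun z hz ↦ by
        have h := neronLattice_mem_of_twist_of_gaussSum_sq hd0 u hu one_ne_zero hΔ1 hG' D.isNeronLattice
          D'.isNeronLattice z hz
        push_cast at h ⊢
        simpa using h
      exact maninConstant_dvd_mul_of_charTwist_gamma0 D D' hD' hχ hprim hNdvd hM' hcoef D'.isNeronLattice
        2 hmem
    · -- backward: coefficient relation read in reverse (`χ² = 1` off even `n`), lattice step `_rev`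
      have hcoef' : ∀ n : ℕ, cuspCoeff D.f n = χ n * cuspCoeff D'.f n := fun n ↦ by
        have h := cuspCoeff_eq_chi_mul_of_twist_even hd0 u hu rfl (hoddC W) heven hW'0 D D' n
        by_cases h2 : 2 ∣ n
        · rw [D.isNewformOf.2 n, hW0 n h2, heven n h2]; simp
        · have hχ1 : χ n * χ n = 1 := by
            rw [← hεχ n]
            rcases Int.natAbs_eq_iff.mp (hε n h2) with h1 | h1 <;> simp [h1]
          rw [h, ← mul_assoc, hχ1, one_mul]
      have hmem' : ∀ z : ℂ, gaussSum χ (ZMod.stdAddChar (N := 2 * k)) * z ∈ D'.L.lattice →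
          ((2 * d : ℤ) : ℂ) * z ∈ D.L.lattice := fun z hz ↦ by
        have h := neronLattice_mem_of_twist_of_gaussSum_sq_rev hd0 u hu hΔ hG' D.isNeronLattice
          D'.isNeronLattice z hz
        push_cast at h ⊢
        exact h
      exact maninConstant_dvd_mul_of_charTwist_gamma0 D' D hD hχ hprim hNdvd' hM hcoef' D.isNeronLattice
        (2 * d) hmem'

/-- **S-an-14 + E-an-18r at `χ₋₄`.** [cite: Watkins2002, §2.1] [cite: Stevens1989, Lemma (5.4)] -/
theorem evenCommuting_negOne :
    EvenCommutingOrbitDegreeIdentity (-1) 4 ∧ EvenCommutingOrbitManinChain (-1) 4 := by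
  haveI : NeZero (2 : ℕ) := ⟨by norm_num⟩
  refine evenCommuting_of_char (k := 2) (by norm_num) isQuadratic_χ₄_ringHomComp isPrimitive_χ₄_ringHomComp
    (by rw [gaussSum_χ₄_ringHomComp_sq]; push_cast; ring) (fun n ↦ (ZMod.χ₄ n : ℤ)) (fun n hn ↦ ?_)
    (fun n ↦ (χ₄_ringHomComp_apply_natCast n).symm) (fun X _ n hn ↦ ?_) (a := 1) (by norm_num) (by norm_num)
  · rw [ZMod.χ₄_nat_eq_if_mod_four, if_neg (fun h ↦ hn (Nat.dvd_of_mod_eq_zero h))]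
    split_ifs <;> simp
  · rw [show ((-1 : ℤ) : ℚ) = -1 by norm_num, X.LFunction_quadraticTwist_neg_one_apply_of_odd hn]

/-- **S-an-14 + E-an-18r at `χ₈`.** [cite: Watkins2002, §2.1] [cite: Stevens1989, Lemma (5.4)] -/
theorem evenCommuting_two :
    EvenCommutingOrbitDegreeIdentity 2 8 ∧ EvenCommutingOrbitManinChain 2 8 := by
  haveI : NeZero (4 : ℕ) := ⟨by norm_num⟩
  refine evenCommuting_of_char (k := 4) (by norm_num) isQuadratic_χ₈_ringHomComp isPrimitive_χ₈_ringHomComp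
    (by rw [gaussSum_χ₈_ringHomComp_sq]; push_cast; ring) (fun n ↦ (ZMod.χ₈ n : ℤ)) (fun n hn ↦ ?_)
    (fun n ↦ (χ₈_ringHomComp_apply_natCast n).symm) (fun X _ n hn ↦ ?_) (a := 2) (by norm_num) (by norm_num)
  · rw [ZMod.χ₈_nat_eq_if_mod_eight, if_neg (fun h ↦ hn (Nat.dvd_of_mod_eq_zero h))]
    split_ifs <;> simp
  · rw [show ((2 : ℤ) : ℚ) = 2 by norm_num, X.LFunction_quadraticTwist_two_apply_of_odd hn]

/-- **S-an-14 + E-an-18r at `χ₋₈`.** [cite: Watkins2002, §2.1] [cite: Stevens1989, Lemma (5.4)] -/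
theorem evenCommuting_negTwo :
    EvenCommutingOrbitDegreeIdentity (-2) 8 ∧ EvenCommutingOrbitManinChain (-2) 8 := by
  haveI : NeZero (4 : ℕ) := ⟨by norm_num⟩
  refine evenCommuting_of_char (k := 4) (by norm_num) isQuadratic_χ₈'_ringHomComp
    isPrimitive_χ₈'_ringHomComp (by rw [gaussSum_χ₈'_ringHomComp_sq]; push_cast; ring)
    (fun n ↦ (ZMod.χ₈' n : ℤ)) (fun n hn ↦ ?_) (fun n ↦ (χ₈'_ringHomComp_apply_natCast n).symm)
    (fun X _ n hn ↦ ?_) (a := 2) (by norm_num) (by norm_num)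
  · rw [ZMod.χ₈'_nat_eq_if_mod_eight, if_neg (fun h ↦ hn (Nat.dvd_of_mod_eq_zero h))]
    split_ifs <;> simp
  · rw [show ((-2 : ℤ) : ℚ) = -2 by norm_num, X.LFunction_quadraticTwist_neg_two_apply_of_odd hn]

/-- Elementary: `c′ ∣ 2c`, `c ∣ 2^j·c′`, `deg′·c² = a·deg·c′²` ⇒ `deg′·4^i = 4a·deg` for some `i ≤ j + 1`
(`2c = c′k`, `k ∣ 2^{j+1}`, `deg′k² = 4a·deg`). [elementary] -/
theorem exists_deg_mul_four_pow_eq {c c' : ℤ} {deg deg' a j : ℕ} (hc : c ≠ 0) (hc' : c' ≠ 0)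
    (h1 : c' ∣ 2 * c) (h2 : c ∣ 2 ^ j * c') (hI : (deg' : ℤ) * c ^ 2 = (a : ℤ) * deg * c' ^ 2) :
    ∃ i ≤ j + 1, deg' * 4 ^ i = 4 * a * deg := by
  obtain ⟨k, hk⟩ := h1
  obtain ⟨k', hk'⟩ := h2
  have hK := deg_mul_sq_eq_of_two_mul_eq hc hk hI
  have hkd : k ∣ 2 * 2 ^ j := dvd_of_two_mul_eq_of_mul_eq hc' hk hk'
  have hkabs : k.natAbs ∣ 2 ^ (j + 1) := by
    have := Int.natAbs_dvd_natAbs.mpr hkd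
    simpa [pow_succ, mul_comm, Int.natAbs_mul, Int.natAbs_pow] using this
  obtain ⟨i, hi, hki⟩ := (Nat.dvd_prime_pow Nat.prime_two).mp hkabs
  refine ⟨i, hi, ?_⟩
  have hksq : k ^ 2 = ((k.natAbs : ℕ) : ℤ) ^ 2 := (Int.natAbs_pow_two k).symm
  rw [hksq, hki] at hK
  have h4 : ((2 ^ i : ℕ) : ℤ) ^ 2 = ((4 ^ i : ℕ) : ℤ) := by
    push_cast
    rw [← pow_mul, show (4 : ℤ) = 2 ^ 2 by norm_num, ← pow_mul, mul_comm]
  rw [h4] at hK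
  exact_mod_cast hK

/-- Elementary: `deg′·c² = a·deg·c′²`, `c, c′, a, deg ≠ 0` ⇒ (`deg′ = a·deg ⟺ c′² = c²`). [elementary] -/
theorem deg_eq_iff_c_sq_eq {c c' : ℤ} {deg deg' a : ℕ} (hc : c ≠ 0) (hdeg : deg ≠ 0) (ha : a ≠ 0)
    (hI : (deg' : ℤ) * c ^ 2 = (a : ℤ) * deg * c' ^ 2) : deg' = a * deg ↔ c' ^ 2 = c ^ 2 := by
  constructor
  · intro he
    have he' : (deg' : ℤ) = (a : ℤ) * deg := by exact_mod_cast he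
    rw [he'] at hI
    have had : ((a : ℤ) * deg : ℤ) ≠ 0 := by exact_mod_cast mul_ne_zero ha hdeg
    exact (mul_left_cancel₀ had hI).symm
  · intro hcc
    rw [← hcc] at hI
    have hc'2 : c' ^ 2 ≠ 0 := by rw [hcc]; exact pow_ne_zero 2 hc
    exact_mod_cast mul_right_cancel₀ hc'2 hI

/-- **E-an-20 at `χ₋₄` is a THEOREM** (E-an-18r at `(−1, 4)`: `c′ ∣ 2c`, `c ∣ 2c′`; S-an-14:
`deg′c² = deg·c′²`; then `deg′·4^i = 4·deg`, `i ≤ 2`). -/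
theorem negOneCommutingOrbitDegreeTrichotomy_holds : NegOneCommutingOrbitDegreeTrichotomy := by
  intro W W' _ _ _ _ _ _ u D D' hM hN hu hD hD' hΔ
  obtain ⟨hI, hC⟩ := evenCommuting_negOne
  have hu' : u • W.quadraticTwist (((-1 : ℤ) : ℤ) : ℚ) = W' := by simpa using hu
  have hΔ' : W'.Δ = (((-1 : ℤ) : ℤ) : ℚ) ^ 6 * W.Δ := by rw [hΔ]; norm_num
  have hId := hI W W' u D D' hM hN hu' hΔ'
  obtain ⟨h1, h2⟩ := hC W W' u D D' hM hN hu' hD hD' hΔ'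
  have hc : D.c ≠ 0 := D.maninConstant_ne_zero_holds
  have hc' : D'.c ≠ 0 := D'.maninConstant_ne_zero_holds
  rw [abs_neg, abs_one, one_mul] at hId
  have hId' : (D'.modularDegree : ℤ) * D.c ^ 2 = ((1 : ℕ) : ℤ) * D.modularDegree * D'.c ^ 2 := by
    rw [Nat.cast_one, one_mul]; exact hId
  have h2' : D.c ∣ 2 ^ 1 * D'.c := by
    rw [show (2 : ℤ) * (-1 : ℤ) * D'.c = -(2 ^ 1 * D'.c) by ring, dvd_neg] at h2
    exact h2
  have hiff := deg_eq_iff_c_sq_eq hc D.deg_pos.ne' one_ne_zero hId'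
  rw [one_mul] at hiff
  refine ⟨?_, hiff⟩
  obtain ⟨i, hi, hdeg⟩ := exists_deg_mul_four_pow_eq hc hc' h1 h2' hId'
  interval_cases i <;> omega

end EvenDegree

end Summit.BirchSwinnertonDyer.Rank1Residual.ManinAdditive

end
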